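import Literature.NumberTheory.LFunctions.WeilThetaPhiMellin
import Summits.RiemannHypothesis.RiemannHypothesis.Theorems.GroundBartaGroundBartaFloorRateDecay
import HarnessLib

/-!
# Sharp super-exponential tail of `Φ′` (route `RiemannHypothesis/GroundBarta`, rung 3
`PolarPerronFrobenius`, stmt-RiemannHypothesis-18390 — theta-vector toolkit)

The tree's `abs_weilThetaPhiDeriv_le` bounds `|Φ′(t)|` by `5088 e^{|t|/2 − (π/2)e^{2|t|}}` — half the
true exponent.  For the collar estimates of the smooth theta window vector (rate `e^{-π e^{2a}}`)
we need the FULL exponent: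

  `|Φ′(t)| ≤ C₁ e^{13|t|/2} e^{−π e^{2|t|}}`  (`exists_abs_weilThetaPhiDeriv_le_sharp`),

from the one-series form `Φ_RT′(u) = −eᵘ Σ_n y_n(8y_n² − 30y_n + 15)e^{−y_n}`, `y_n = π(n+1)²x`,
`x = e^{4u}` (`deBruijnPhiDeriv_eq_tsum`): `|term_n| ≤ 53 y_n³ e^{−y_n} = 53π³x³(n+1)⁶ e^{−πx}
e^{−πx((n+1)²−1)} ≤ 53π³x³ e^{−πx} · (n+1)⁶e^{−3((n+1)²−1)}`, and the last factor is summable.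
Also recorded: the envelope `y ↦ 13y/2 − πe^{2y}` is decreasing on `[0, ∞)` and the collar
conversions used downstream.  RH-free, elementary.  References: de Bruijn / Rodgers–Tao 2020 (series
of `Φ`); Titchmarsh §10.1.
-/

set_option linter.dupNamespace false

noncomputable section

open Set MeasureTheory Filter Complex
open scoped Real Topology

namespace Summit.RiemannHypothesis.RiemannHypothesis.Theorems.PolarPerronFrobenius

open Literature.NumberTheory.LFunctions
open Summit.RiemannHypothesis.RiemannHypothesis.Theorems.GroundBartaFloor

/-! ## The summable constant -/

/-- The majorant `(n+1)⁶ e^{−3((n+1)²−1)}` is summable (dominated by `e³ (n+1)⁶ e^{−3(n+1)}`). [folklore] -/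
theorem phiTail_summable_majorant :
    Summable fun n : ℕ => ((n : ℝ) + 1) ^ 6 * rexp (-(3 * (((n : ℝ) + 1) ^ 2 - 1))) := by
  have h0 : Summable fun n : ℕ => ((n : ℝ)) ^ 6 * rexp (-(3 * (n : ℝ))) := by
    have := Real.summable_pow_mul_exp_neg_nat_mul 6 (by norm_num : (0 : ℝ) < 3)
    refine this.congr fun n => ?_
    ring_nf
  have h1 : Summable fun n : ℕ => (((n + 1 : ℕ) : ℝ)) ^ 6 * rexp (-(3 * ((n + 1 : ℕ) : ℝ))) :=
    (summable_nat_add_iff 1).2 h0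
  have h2 : Summable fun n : ℕ => rexp 3 * ((((n + 1 : ℕ) : ℝ)) ^ 6 * rexp (-(3 * ((n + 1 : ℕ) : ℝ)))) :=
    h1.mul_left _
  refine h2.of_nonneg_of_le (fun n => by positivity) fun n => ?_
  push_cast
  rw [← mul_assoc, mul_comm (rexp 3), mul_assoc, ← Real.exp_add]
  refine mul_le_mul_of_nonneg_left (Real.exp_le_exp.2 ?_) (by positivity)
  nlinarith [(n.cast_nonneg : (0 : ℝ) ≤ n)]

/-! ## The sharp termwise bound -/

/-- Termwise: for `x ≥ 1`, `|y_n(8y_n² − 30y_n + 15) e^{−y_n}| ≤ 53π³ x³ e^{−πx} · (n+1)⁶e^{−3((n+1)²−1)}`.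
[folklore] -/
theorem abs_phiPolyTerm_deriv_le_sharp {x : ℝ} (hx : 1 ≤ x) (n : ℕ) :
    |phiPolyTerm 15 (-30) 8 0 x n| ≤
      53 * π ^ 3 * x ^ 3 * rexp (-(π * x)) * (((n : ℝ) + 1) ^ 6 * rexp (-(3 * (((n : ℝ) + 1) ^ 2 - 1)))) := by
  have hπ := Real.pi_gt_three
  have hn : (0 : ℝ) ≤ n := n.cast_nonneg
  set y := thetaFreq x n with hydef
  have hyx : π * x ≤ y := pi_mul_le_thetaFreq (zero_le_one.trans hx) n
  have hy1 : 1 ≤ y := by nlinarith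
  have hy0 : 0 ≤ y := zero_le_one.trans hy1
  have hpoly : |15 * y + -30 * y ^ 2 + 8 * y ^ 3 + 0 * y ^ 4| ≤ 53 * y ^ 3 := by
    have h1 : y ≤ y ^ 3 := by
      nlinarith [mul_nonneg (mul_nonneg hy0 (sub_nonneg.2 hy1)) (by linarith : (0 : ℝ) ≤ y + 1)]
    have h2 : y ^ 2 ≤ y ^ 3 := by nlinarith [mul_nonneg (sq_nonneg y) (sub_nonneg.2 hy1)]
    rw [abs_le]
    constructor <;> nlinarith
  -- `y = π (n+1)² x`, so `y³ = π³ (n+1)⁶ x³` and `y − πx = πx((n+1)² − 1) ≥ 3((n+1)² − 1)`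
  have hy : y = π * ((n : ℝ) + 1) ^ 2 * x := rfl
  have hsq : (1 : ℝ) ≤ ((n : ℝ) + 1) ^ 2 := by nlinarith
  have hgap : 3 * (((n : ℝ) + 1) ^ 2 - 1) ≤ y - π * x := by
    rw [hy]
    have : π * x * (((n : ℝ) + 1) ^ 2 - 1) = π * ((n : ℝ) + 1) ^ 2 * x - π * x := by ring
    rw [← this]
    have h3 : (3 : ℝ) ≤ π * x := by nlinarith
    exact mul_le_mul_of_nonneg_right h3 (by linarith)
  have hexp : rexp (-y) ≤ rexp (-(π * x)) * rexp (-(3 * (((n : ℝ) + 1) ^ 2 - 1))) := by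
    rw [← Real.exp_add]
    exact Real.exp_le_exp.2 (by linarith)
  have hy3 : y ^ 3 = π ^ 3 * x ^ 3 * ((n : ℝ) + 1) ^ 6 := by rw [hy]; ring
  calc |phiPolyTerm 15 (-30) 8 0 x n|
      = |15 * y + -30 * y ^ 2 + 8 * y ^ 3 + 0 * y ^ 4| * rexp (-y) := by
        rw [phiPolyTerm, abs_mul, abs_of_pos (Real.exp_pos _)]
    _ ≤ 53 * y ^ 3 * rexp (-y) := by gcongr
    _ ≤ 53 * y ^ 3 * (rexp (-(π * x)) * rexp (-(3 * (((n : ℝ) + 1) ^ 2 - 1)))) := by gcongr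
    _ = _ := by rw [hy3]; ring

/-- **Sharp super-exponential decay of `Φ_RT′`**: there is `C₁` with
`|deBruijnPhiDeriv u| ≤ C₁ eᵘ x³ e^{−πx}`, `x = e^{4u}`, for all `u ≥ 0`. [folklore] -/
theorem exists_abs_deBruijnPhiDeriv_le_sharp :
    ∃ C₁ : ℝ, 0 ≤ C₁ ∧ ∀ u : ℝ, 0 ≤ u →
      |deBruijnPhiDeriv u| ≤ C₁ * rexp u * rexp (4 * u) ^ 3 * rexp (-(π * rexp (4 * u))) := by
  set K : ℝ := ∑' n : ℕ, ((n : ℝ) + 1) ^ 6 * rexp (-(3 * (((n : ℝ) + 1) ^ 2 - 1))) with hK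
  have hK0 : 0 ≤ K := tsum_nonneg fun n => by positivity
  refine ⟨53 * π ^ 3 * K, by positivity, fun u hu => ?_⟩
  have hx1 : 1 ≤ rexp (4 * u) := Real.one_le_exp (by linarith)
  set x := rexp (4 * u) with hxdef
  have hsum : HasSum (fun n : ℕ => 53 * π ^ 3 * x ^ 3 * rexp (-(π * x)) *
      (((n : ℝ) + 1) ^ 6 * rexp (-(3 * (((n : ℝ) + 1) ^ 2 - 1)))))
      (53 * π ^ 3 * x ^ 3 * rexp (-(π * x)) * K) :=
    phiTail_summable_majorant.hasSum.mul_left _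
  have hbound : ‖∑' n, phiPolyTerm 15 (-30) 8 0 x n‖ ≤ 53 * π ^ 3 * x ^ 3 * rexp (-(π * x)) * K :=
    tsum_of_norm_bounded hsum fun n => by
      rw [Real.norm_eq_abs]; exact abs_phiPolyTerm_deriv_le_sharp hx1 n
  rw [Real.norm_eq_abs] at hbound
  rw [deBruijnPhiDeriv_eq_tsum, abs_neg, abs_mul, abs_of_pos (Real.exp_pos u), ← hxdef]
  calc rexp u * |∑' n, phiPolyTerm 15 (-30) 8 0 x n|
      ≤ rexp u * (53 * π ^ 3 * x ^ 3 * rexp (-(π * x)) * K) :=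
        mul_le_mul_of_nonneg_left hbound (Real.exp_pos u).le
    _ = 53 * π ^ 3 * K * rexp u * x ^ 3 * rexp (-(π * x)) := by ring

/-- **Sharp super-exponential decay of `Φ′ = weilThetaPhiDeriv`** (two-sided, by oddness):
`|Φ′(t)| ≤ C₁ e^{13|t|/2} e^{−π e^{2|t|}}`. [folklore] -/
theorem exists_abs_weilThetaPhiDeriv_le_sharp :
    ∃ C₁ : ℝ, 0 ≤ C₁ ∧ ∀ t : ℝ,
      |weilThetaPhiDeriv t| ≤ C₁ * rexp (13 / 2 * |t|) * rexp (-(π * rexp (2 * |t|))) := by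
  obtain ⟨C₁, hC₁, hb⟩ := exists_abs_deBruijnPhiDeriv_le_sharp
  refine ⟨C₁, hC₁, fun t => ?_⟩
  have key : ∀ s : ℝ, 0 ≤ s →
      |weilThetaPhiDeriv s| ≤ C₁ * rexp (13 / 2 * s) * rexp (-(π * rexp (2 * s))) := by
    intro s hs
    have h := hb (s / 2) (by linarith)
    have e1 : rexp (4 * (s / 2)) = rexp (2 * s) := by congr 1; ring
    rw [e1] at h
    have e2 : C₁ * rexp (s / 2) * rexp (2 * s) ^ 3 * rexp (-(π * rexp (2 * s))) =
        C₁ * rexp (13 / 2 * s) * rexp (-(π * rexp (2 * s))) := by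
      rw [show rexp (2 * s) ^ 3 = rexp (3 * (2 * s)) by rw [← Real.exp_nat_mul]; norm_num,
        mul_assoc C₁, ← Real.exp_add]
      congr 2
      ring
    rw [weilThetaPhiDeriv]
    exact h.trans_eq e2
  rcases le_or_gt 0 t with ht | ht
  · simpa [abs_of_nonneg ht] using key t ht
  · have := key (-t) (by linarith)
    rw [weilThetaPhiDeriv_neg, abs_neg] at this
    simpa [abs_of_neg ht] using this

end Summit.RiemannHypothesis.RiemannHypothesis.Theorems.PolarPerronFrobenius

end
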